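import Mathlib
import Summits.Ventures.HodgeRepro.Tier4.Line4.IntegFolded
import Summits.Ventures.HodgeRepro.Tier4.Line4.IntegProper
import Summits.Ventures.HodgeRepro.Tier4.Line4.MainTermInstance
import Summits.Ventures.HodgeRepro.Tier4.Line4.L1ClassV3

/-!
# Tier4/Line4/ChainInputsBounded — C-L4-CHAININPUTS-GLOBAL, part 1: the integrability clauses (A1), (A3)/(B3), (B2) of
`ChainInputs` for a bounded continuous (product) test function, and the bridge to display (8)

Blind re-derivation cell `pub-hodge-repro`, Tier 4 «prove the step» (README §9–§10), seat t4-L2-p3 (gen 5; plan-4 g6's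
cut S15809 / S15814 with L4-x2's census S15812 as the brief; statements S15822).  Tree path
`lean/Summits/Ventures/HodgeRepro/Tier4/Line4/ChainInputsBounded.lean`.  Imports L1-p5's IntegFolded (whose
compactly supported proofs are re-typed here with the BOUND as the hypothesis), L2-p1's IntegProper
(`isClosedEmbedding_torusFin'_coe`), L4-p1's MainTermInstance (`ChainInputs`) and L1ClassV3 (`PoincareOfDecay`,
`HasDecay3`, `IsFinFactor`, `prodFn`).

* `continuous_innerFn`, `norm_innerFn_le`, `norm_innerFn_eq`: the inner integrand `t′ ↦ conj χ′(t′) F(t⁻¹ γ t′)`;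
* (a) `integrable_innerFn_restrict_of_bound` (A1), `continuous_innerInt_of_bound`,
  `integrable_chi_mul_innerInt_restrict_of_bound` (A3, and B3 at `δ⁻¹ γ₀ δ′`) for a continuous `F` bounded by `C`
  (`μ_{T′}(D_{T′}) < ∞`, `μ_T(D_T) < ∞`);
* (b) `integrable_innerFn_full_of_isProductFn` (B2) over ALL of `T′(𝔸)` for a product `F = F_∞ ⊗ F_f` with a
  compactly supported finite factor: the `t′`-support is `T′_∞ × {b′ : (s⁻¹ γ₀)_f b′ ∈ supp F_f}` along
  `torusSplit′`, compact under `[CompactSpace (torusInf' W)]`;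
* `poincareSummable_of_poincareOfDecay` — THE BRIDGE: display (8) `PoincareOfDecay` at `finf′ ⊗ ffin`;
* `exists_bound_of_isProductFn` — a product with bounded `F_∞` and compactly supported `F_f` is bounded.

Part 2 (`Tier4/Line4/ChainInputsGlobal`): the four sums (A2), (A4), `hs`, (B4) from the Poincaré clause and the
assembly of the bundle.  No printed input is consumed.  HC_CM is NOT proved by anyone in this repository.
-/

set_option autoImplicit false
noncomputable section
namespace Summit.Ventures.HodgeRepro.Tier4.Line4
open Summit.Ventures.HodgeRepro.Tier4 Summit.Ventures.HodgeRepro.Tier4.Common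
  Summit.Ventures.HodgeRepro.Tier4.Line1 MeasureTheory
open scoped ComplexConjugate Topology Pointwise NNReal

section Global
variable {k : Type} [Field k] [NumberField k] (W : PlaneData k) [MeasurableSpace (GA W)] [BorelSpace (GA W)]
  (R : RTFData W)

omit [BorelSpace (GA W)] in
/-- **THE BRIDGE**: display (8) `PoincareOfDecay` at the witness gives the Poincaré clause of `finf′ ⊗ ffin`
(L1ClassV3 L129 applied). -/
theorem poincareSummable_of_poincareOfDecay (S : RTF.Setting (GA W)) (h8 : L1Class.PoincareOfDecay W S)
    {finf ffin : GA W → ℂ} (hc : Continuous finf) (hd : L1Class.HasDecay3 W finf)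
    (hf : L1Class.IsFinFactor W ffin) : L1Class.PoincareSummable S (L1Class.prodFn W finf ffin) :=
  h8 finf ffin hc hd hf

omit [BorelSpace (GA W)] in
/-- the inner integrand is continuous for continuous `F`. -/
theorem continuous_innerFn (hc' : Continuous R.chi') (F : GA W → ℂ) (hFc : Continuous F) (γ : GA W)
    (t : torusT W) : Continuous (innerFn W R F γ t) := by
  unfold innerFn RTFData.chi'conj
  exact (Complex.continuous_conj.comp hc').mul (hFc.comp (continuous_const.mul continuous_subtype_val))

omit [BorelSpace (GA W)] in
/-- the inner integrand is bounded by the bound of `F` (`‖χ′‖ = 1`). -/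
theorem norm_innerFn_le (hu' : ∀ a, ‖R.chi' a‖ = 1) (F : GA W → ℂ) (C : ℝ) (hC : ∀ x, ‖F x‖ ≤ C) (γ : GA W)
    (t : torusT W) (t' : torusT' W) : ‖innerFn W R F γ t t'‖ ≤ C := by
  simp only [innerFn, RTFData.chi'conj, norm_mul, Complex.norm_conj, hu', one_mul]
  exact hC _

omit [BorelSpace (GA W)] in
/-- the inner integrand's norm is the norm of `F` on the orbit. -/
theorem norm_innerFn_eq (hu' : ∀ a, ‖R.chi' a‖ = 1) (F : GA W → ℂ) (γ : GA W) (t : torusT W) (t' : torusT' W) :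
    ‖innerFn W R F γ t t'‖ = ‖F ((t : GA W)⁻¹ * γ * (t' : GA W))‖ := by
  simp only [innerFn, RTFData.chi'conj, norm_mul, Complex.norm_conj, hu', one_mul]

/-- **(A1) with the BOUND as the hypothesis** (IntegFolded's `integrable_innerFn_restrict` re-typed): the inner
integrand is integrable on `D_{T′}` — continuous, bounded by `C`, `μ_{T′}(D_{T′}) < ∞`. -/
theorem integrable_innerFn_restrict_of_bound (hR : R.IsHaar) (hc' : Continuous R.chi') (hu' : ∀ a, ‖R.chi' a‖ = 1)
    (F : GA W → ℂ) (hFc : Continuous F) (C : ℝ) (hC : ∀ x, ‖F x‖ ≤ C) (γ : GA W) (t : torusT W) :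
    Integrable (innerFn W R F γ t) (R.μT'.restrict R.DT') := by
  haveI : SecondCountableTopology (GA W) := secondCountable_GA W
  haveI : SecondCountableTopology (torusT' W) :=
    TopologicalSpace.Subtype.secondCountableTopology (torusT' W : Set (GA W))
  haveI : IsFiniteMeasure (R.μT'.restrict R.DT') := isFiniteMeasure_restrict.2 hR.2.2.2.2.2.ne
  refine Integrable.mono' (integrable_const C) (continuous_innerFn W R hc' F hFc γ t).aestronglyMeasurable
    (ae_of_all _ fun t' => norm_innerFn_le W R hu' F C hC γ t t')

/-- the inner integral is continuous in `t` for continuous bounded `F` (dominated convergence). -/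
theorem continuous_innerInt_of_bound (hR : R.IsHaar) (hc' : Continuous R.chi') (hu' : ∀ a, ‖R.chi' a‖ = 1)
    (F : GA W → ℂ) (hFc : Continuous F) (C : ℝ) (hC : ∀ x, ‖F x‖ ≤ C) (γ : GA W) :
    Continuous fun t : torusT W => innerInt W R F γ t := by
  haveI : SecondCountableTopology (GA W) := secondCountable_GA W
  haveI : SecondCountableTopology (torusT W) := TopologicalSpace.Subtype.secondCountableTopology (torusT W : Set (GA W))
  haveI : SecondCountableTopology (torusT' W) :=
    TopologicalSpace.Subtype.secondCountableTopology (torusT' W : Set (GA W))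
  haveI : IsFiniteMeasure (R.μT'.restrict R.DT') := isFiniteMeasure_restrict.2 hR.2.2.2.2.2.ne
  unfold innerInt
  refine continuous_of_dominated (bound := fun _ => C) (fun t => ?_)
    (fun t => ae_of_all _ fun t' => norm_innerFn_le W R hu' F C hC γ t t') (integrable_const C)
    (ae_of_all _ fun t' => ?_)
  · exact (continuous_innerFn W R hc' F hFc γ t).aestronglyMeasurable
  · unfold innerFn RTFData.chi'conj
    exact continuous_const.mul
      (hFc.comp ((continuous_subtype_val.inv.mul continuous_const).mul continuous_const))

/-- **(A3)/(B3) with the BOUND as the hypothesis** (IntegFolded's `integrable_chi_mul_innerInt_restrict` re-typed):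
`t ↦ χ(t) I_γ(t)` is integrable on `D_T` (bounded by `C · μ_{T′}(D_{T′})`, continuous). -/
theorem integrable_chi_mul_innerInt_restrict_of_bound (hR : R.IsHaar) (hc : Continuous R.chi)
    (hu : ∀ a, ‖R.chi a‖ = 1) (hc' : Continuous R.chi') (hu' : ∀ a, ‖R.chi' a‖ = 1)
    (F : GA W → ℂ) (hFc : Continuous F) (C : ℝ) (hC : ∀ x, ‖F x‖ ≤ C) (γ : GA W) :
    Integrable (fun t : torusT W => R.chi t * innerInt W R F γ t) (R.μT.restrict R.DT) := by
  haveI : SecondCountableTopology (GA W) := secondCountable_GA W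
  haveI : SecondCountableTopology (torusT W) := TopologicalSpace.Subtype.secondCountableTopology (torusT W : Set (GA W))
  haveI : IsFiniteMeasure (R.μT.restrict R.DT) := isFiniteMeasure_restrict.2 hR.2.2.2.1.ne
  have hmeas : AEStronglyMeasurable (fun t : torusT W => R.chi t * innerInt W R F γ t) (R.μT.restrict R.DT) :=
    (hc.mul (continuous_innerInt_of_bound W R hR hc' hu' F hFc C hC γ)).aestronglyMeasurable
  refine Integrable.mono' (integrable_const (C * R.μT'.real R.DT')) hmeas (ae_of_all _ fun t => ?_)
  rw [norm_mul, hu, one_mul]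
  exact norm_setIntegral_le_of_norm_le_const hR.2.2.2.2.2 fun t' _ => norm_innerFn_le W R hu' F C hC γ t t'

/-- **(B2) over ALL of `T′(𝔸)` for a PRODUCT `F = F_∞ ⊗ F_f`** with a compactly supported finite factor: the
`t′`-support of `t′ ↦ F(s⁻¹ γ₀ t′)` lies in `T′_∞ × {b′ : (s⁻¹ γ₀)_f b′ ∈ supp F_f}` along `torusSplit′`, compact
when `T′_∞` is compact. -/
theorem integrable_innerFn_full_of_isProductFn [CompactSpace (torusInf' W)] (hR : R.IsHaar)
    (hc' : Continuous R.chi') (_hu' : ∀ a, ‖R.chi' a‖ = 1) {F Finf Ffin : GA W → ℂ}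
    (hF : IsProductFn W F Finf Ffin) (hFinfc : Continuous Finf) (hfin : L1Class.IsFinFactor W Ffin)
    (γ₀ : GA W) (s : torusT W) : Integrable (innerFn W R F γ₀ s) R.μT' := by
  haveI : R.μT'.IsHaarMeasure := hR.2.1
  have hFeq : F = fun g => Finf (GA.ofInfPart W g) * Ffin (GA.ofFinPart W g) := funext hF
  have hFc : Continuous F := by
    rw [hFeq]
    exact (hFinfc.comp (continuous_ofInfPart W)).mul (hfin.cont.comp (continuous_ofFinPart W))
  have hcont : Continuous (innerFn W R F γ₀ s) := continuous_innerFn W R hc' F hFc γ₀ s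
  -- the compact support of the finite factor, transported
  set K : Set (finitePart W) := tsupport (fun x : finitePart W => Ffin (x : GA W)) with hKdef
  have hK : IsCompact K := hfin.compact
  set a : GA W := GA.ofFinPart W ((s : GA W)⁻¹ * γ₀) with ha
  have hK' : IsCompact ((fun x : finitePart W => a⁻¹ * (x : GA W)) '' K) :=
    hK.image (continuous_const.mul continuous_subtype_val)
  set K'' : Set (torusFin' W) :=
    (fun b : torusFin' W => ((b : torusT' W) : GA W)) ⁻¹' ((fun x : finitePart W => a⁻¹ * (x : GA W)) '' K) with hK''def
  have hK'' : IsCompact K'' := (isClosedEmbedding_torusFin'_coe W).isCompact_preimage hK'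
  have hbig : IsCompact ((torusSplit' W).symm '' (Set.univ ×ˢ K'')) :=
    (isCompact_univ.prod hK'').image (torusSplit' W).symm.continuous
  refine hcont.integrable_of_hasCompactSupport (HasCompactSupport.intro hbig fun t' ht' => ?_)
  by_contra hne
  apply ht'
  -- `F(s⁻¹ γ₀ t′) ≠ 0`, so the finite part of `s⁻¹ γ₀ t′` lies in the support of `F_f`
  have hF0 : F ((s : GA W)⁻¹ * γ₀ * (t' : GA W)) ≠ 0 := by
    intro h0
    apply hne
    simp [innerFn, h0]
  have hff : Ffin (GA.ofFinPart W ((s : GA W)⁻¹ * γ₀ * (t' : GA W))) ≠ 0 := by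
    intro h0
    apply hF0
    rw [hF, h0, mul_zero]
  have hmemK : (⟨GA.ofFinPart W ((s : GA W)⁻¹ * γ₀ * (t' : GA W)), ofFinPart_mem_finitePart W _⟩ : finitePart W) ∈ K :=
    subset_tsupport _ hff
  have hsplit : GA.ofFinPart W ((s : GA W)⁻¹ * γ₀ * (t' : GA W)) = a * GA.ofFinPart W (t' : GA W) := by
    rw [ha, ofFinPart_mul]
  have hfin' : finTf' W t' ∈ K'' := by
    refine ⟨⟨GA.ofFinPart W ((s : GA W)⁻¹ * γ₀ * (t' : GA W)), ofFinPart_mem_finitePart W _⟩, hmemK, ?_⟩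
    show a⁻¹ * GA.ofFinPart W ((s : GA W)⁻¹ * γ₀ * (t' : GA W)) = GA.ofFinPart W (t' : GA W)
    rw [hsplit, inv_mul_cancel_left]
  refine ⟨torusSplit' W t', ⟨Set.mem_univ _, hfin'⟩, (torusSplit' W).symm_apply_apply t'⟩

omit [MeasurableSpace (GA W)] [BorelSpace (GA W)] in
/-- a product `F = F_∞ ⊗ F_f` with bounded `F_∞` and compactly supported continuous `F_f` is bounded. -/
theorem exists_bound_of_isProductFn {F Finf Ffin : GA W → ℂ} (hF : IsProductFn W F Finf Ffin) (C : ℝ)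
    (hC : ∀ x, ‖Finf x‖ ≤ C) (hfin : L1Class.IsFinFactor W Ffin) : ∃ C' : ℝ, ∀ x, ‖F x‖ ≤ C' := by
  obtain ⟨Cf, hCf⟩ := (hfin.cont.comp continuous_subtype_val).bounded_above_of_compact_support hfin.compact
  have hC0 : 0 ≤ C := (norm_nonneg _).trans (hC 1)
  refine ⟨C * Cf, fun x => ?_⟩
  rw [hF x, norm_mul]
  refine mul_le_mul (hC _) ?_ (norm_nonneg _) hC0
  exact hCf ⟨GA.ofFinPart W x, ofFinPart_mem_finitePart W x⟩


end Global


end Summit.Ventures.HodgeRepro.Tier4.Line4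
end
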